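/-
Copyright: the b2b-balaban cell (near-miss cell 7), T⁴-continuum fan-out; row NE7b ROUND-2 swarm, seat
t4-ne7b-formalise-leaf-04 (gen 3) — row S6g′(a), file 7 «THE BRIDGE TO THE COUNT'S JOINS» (journal CLAIM l.9299,
located interface point F-leaf04g3-1 l.9871).  Released under the licence of the surrounding project.
-/
import Summits.QuantumFields.BalabanUV.T4Continuum.Support.HistoryZoneMassPieces
import Summits.QuantumFields.BalabanUV.T4Continuum.Support.HistoryJoinsAdm
import Summits.QuantumFields.BalabanUV.T4Continuum.Support.HistoryZoneMassJoins

/-!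
# Zone mass for PIECES, IV: the bridge from the COUNT's canonical admissibility to cluster contact of the pieces

Summits-side support leaf of the T⁴-continuum cell (rung (B)+1 on a FINITE torus only; NOT infinite volume, NOT the
mass gap, NOT the Clay statement; NOT a proof of the spine estimate NE7b).  Row NE7b, route «COUNT», row S6g′
«MASS-BASED SIBLING COUNT» (R-OWNER-22-12 (2)), step (a) for the COUNT (F-leaf04g3-1): `HistoryZoneMassCluster` proves
the cardinality law for the PIECES of a structure read by the region map under the cluster-contact binder
`hconn : ∀ t₀ Y Z e, merge Y Z e ∈ parts sh t₀ G → TConn («zones at (sh e).step share a cell») (parts sh (sh e).step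
(merge Y Z e))` over THIS lineage's pieces `HistoryZoneEvolve.parts`; the COUNT (`HistoryJoinsCount`, leaf-05 g2) has
canonical admissibility `HistoryJoinsAdm.CAdm zone ρ c₀ st G P` = a contact FOREST (`HistorySiblingSymmetry.ForestAdm`)
among leaf-05 g2's `HistoryJoins.jparts` at every join `q ∈ HistoryJoins.croots st G`.  This file is the bridge:
(1) under leaf-02 g3's dating display `HistoryZoneMassJoins.Dated` (free on the pedigree road,
`HistoryZoneMassDatingGen`) the cut-`t` pieces ARE the step-`t` cluster parts with renewals stripped, in order
(`parts_eq_map_strip`); (2) every piece that is a merger IS a join (`exists_mem_croots_of_mem_parts`); (3) a contact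
forest makes the part list touch-connected (`tconn_of_forestAdm`); whence **`hconn_of_cadm`**: `CAdm` + `Dated` +
«the zone the COUNT displays for a part under its induced relative placement is a renewal-blind function `Zf` of the
part» ⇒ the `hconn` binder for `Zf`.  [folklore] finite combinatorics over the lineage's carriers; nothing is quoted
from print, nothing printed is asserted, no `[cite:]` tag, no `Prop`-valued fact minted; no constants.

WHAT.  §1 `strip` (top renewals removed; `strip_renew`), `parts_eq_of_dated_true`, **`parts_eq_map_strip`**
(`Dated st false t X → parts sh t X = (clusterParts st t X).map (strip ∘ Prod.snd)`, `st = PEv.step ∘ sh`), `dated_node`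
(every merge node of a dated structure is lax-dated at its own step), **`exists_mem_croots_of_mem_parts`**.  §2
`TConn.map` (transport along a map respecting touch), **`tconn_of_forestAdm`** (a contact forest rooted at the host, with
a symmetric touch read on the parts, makes the part list touch-connected — every part reaches the host along its
parent chain, `Acyclic`'s rank).  §3 **`tconn_tparts_of_localTop`** (leaf-05 g2's `LocalTop` at a merger ⇒ `TConn` over
`(jparts st (merge A B e)).map Prod.snd` for «`Zf a ∩ Zf b` non-empty», given the identification `hzone` of the displayed
part zones with `Zf`) and **`hconn_of_cadm`**.  §4 sanity.  NOT HERE: the instance's `zone`∕`Zf` (the translated region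
reading of a placement) — the consumer supplies `hzone`.

HONEST: bookkeeping over OUR carriers; NE7b NOT proved; spine 0∕9.  HONEST DEPENDENCY (cell): continuum YM on T⁴ ⇐
BetaPertH ∧ nine spine estimates (0/9 proved); BetaPertH ⇐ (D1) ∧ (D4) ∧ CAP+tail; G-an2-4 gates asym, D1 and
NE2/3/4.  This file changes none of it.
-/

open Finset
open Literature.MathematicalPhysics.QuantumFieldTheory.Balaban1983to89
open T4PersistenceDictionary T4PartnerMultiplicity T4BranchingRecordsGas
open Summit.QuantumFields.BalabanUV.T4Continuum.ZoneSkeleton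
open Summit.QuantumFields.BalabanUV.T4Continuum.ZoneTorus
open Summit.QuantumFields.BalabanUV.T4Continuum.HistoryZoneEvolve
open Summit.QuantumFields.BalabanUV.T4Continuum.HistoryZoneMassPieces
open Summit.QuantumFields.BalabanUV.T4Continuum.HistorySiblingSymmetry
open Summit.QuantumFields.BalabanUV.T4Continuum.HistoryJoins
open Summit.QuantumFields.BalabanUV.T4Continuum.HistoryJoinsAdm
open Summit.QuantumFields.BalabanUV.T4Continuum.HistoryZoneMassJoins

namespace Summit.QuantumFields.BalabanUV.T4Continuum.HistoryZoneMassBridge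

/-! ## §1 Pieces versus cluster parts and joins -/

section Strip

variable {ε : Type*}

/-- **STRIP THE TOP RENEWALS**: `strip (renew Y _ _) = strip Y`, births and mergers unchanged. [folklore] -/
def strip : Gen ε → Gen ε
  | Gen.born b j => Gen.born b j
  | Gen.renew Y _ _ => strip Y
  | Gen.merge A B e => Gen.merge A B e

/-- stripping a birth [folklore] -/
@[simp] theorem strip_born (b : ε) (j : ℕ) : strip (Gen.born b j) = Gen.born b j := rfl
/-- stripping a renewal [folklore] -/
@[simp] theorem strip_renew (Y : Gen ε) (e : ε) (h : ℕ) : strip (Gen.renew Y e h) = strip Y := rfl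
/-- stripping a merger [folklore] -/
@[simp] theorem strip_merge (A B : Gen ε) (e : ε) : strip (Gen.merge A B e) = Gen.merge A B e := rfl

/-- a renewal-blind function is strip-blind [folklore] -/
theorem apply_strip {β : Type*} (f : Gen ε → β) (hf : ∀ Y e h, f (Gen.renew Y e h) = f Y) :
    ∀ W : Gen ε, f (strip W) = f W
  | Gen.born _ _ => rfl
  | Gen.renew Y e h => by rw [strip_renew, apply_strip f hf Y, hf]
  | Gen.merge _ _ _ => rfl

variable {sh : ε → PEv}

/-- under a STRICT dating at `t` a structure is its own single cut-`t` piece, up to stripping [folklore] -/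
theorem parts_eq_of_dated_true {t : ℕ} : ∀ {Y : Gen ε}, Dated (PEv.step ∘ sh) true t Y → parts sh t Y = [strip Y]
  | Gen.born b j, _ => by simp [parts]
  | Gen.renew Y e h, hD => by
      rw [dated_renew] at hD
      exact parts_eq_of_dated_true (Y := Y) hD
  | Gen.merge A B e, hD => by
      rw [dated_merge] at hD
      have hlt : (sh e).step < t := hD.2.1 rfl
      simp [parts, hlt]

/-- **UNDER A LAX DATING AT `t`, THE CUT-`t` PIECES ARE THE STEP-`t` CLUSTER PARTS, STRIPPED, IN ORDER.** [folklore] -/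
theorem parts_eq_map_strip {t : ℕ} : ∀ {X : Gen ε}, Dated (PEv.step ∘ sh) false t X →
    parts sh t X = (clusterParts (PEv.step ∘ sh) t X).map (fun q => strip q.2)
  | Gen.born b j, _ => by simp [parts]
  | Gen.renew Y e h, hD => by
      rw [dated_renew] at hD
      rw [clusterParts_renew, List.map_singleton]
      exact parts_eq_of_dated_true (Y := Y) hD
  | Gen.merge A B e, hD => by
      rw [dated_merge] at hD
      obtain ⟨hle, -, hA, hB⟩ := hD
      have hle' : (sh e).step ≤ t := hle
      by_cases heq : (sh e).step = t
      · have hA' : Dated (PEv.step ∘ sh) false t A := by rw [← heq]; exact hA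
        have hB' : Dated (PEv.step ∘ sh) false t B := by rw [← heq]; exact hB
        rw [clusterParts_merge_of_eq (PEv.step ∘ sh) (show (PEv.step ∘ sh) e = t from heq), List.map_append,
          List.map_map, List.map_map]
        have hnl : ¬ (sh e).step < t := by omega
        show (if (sh e).step < t then [Gen.merge A B e] else parts sh t A ++ parts sh t B) = _
        rw [if_neg hnl, parts_eq_map_strip hA', parts_eq_map_strip hB']
        rfl
      · have hlt : (sh e).step < t := lt_of_le_of_ne hle' heq
        rw [clusterParts_merge_of_ne (PEv.step ∘ sh) (show (PEv.step ∘ sh) e ≠ t from heq)]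
        simp [parts, hlt]

/-- every merge node of a dated structure is lax-dated at its own step [folklore] -/
theorem dated_node {st : ε → ℕ} {Y Z : Gen ε} {e : ε} :
    ∀ {G : Gen ε} {s : Bool} {t : ℕ}, Dated st s t G → Sub (Gen.merge Y Z e) G →
      Dated st false (st e) (Gen.merge Y Z e) := by
  intro G s t hD hS
  induction hS generalizing s t with
  | refl =>
      rw [dated_merge] at hD ⊢
      exact ⟨le_rfl, fun h => absurd h Bool.false_ne_true, hD.2.2.1, hD.2.2.2⟩
  | renew e' h' _ ih =>
      rw [dated_renew] at hD
      exact ih hD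
  | left B' e' _ ih =>
      rw [dated_merge] at hD
      exact ih hD.2.2.1
  | right A' e' _ ih =>
      rw [dated_merge] at hD
      exact ih hD.2.2.2

/-- **A PIECE THAT IS A MERGER IS A JOIN** (a cluster root, leaf-05 g2's `croots`), for a dated structure; and, for a
cut `t₀ ≤ t`, a join below a step-`t` parent. [folklore] -/
theorem exists_mem_croots_of_mem_parts {Y Z : Gen ε} {e : ε} :
    ∀ {G : Gen ε} {s : Bool} {t t₀ : ℕ}, Dated (PEv.step ∘ sh) s t G → Gen.merge Y Z e ∈ parts sh t₀ G →
      (∃ a, (a, Gen.merge Y Z e) ∈ croots (PEv.step ∘ sh) G) ∧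
        (t₀ ≤ t → ∃ a, (a, Gen.merge Y Z e) ∈ crootsP (PEv.step ∘ sh) (some t) G)
  | Gen.born b j, s, t, t₀, _, hM => by simp [parts] at hM
  | Gen.renew W r h, s, t, t₀, hD, hM => by
      rw [dated_renew] at hD
      have ih := exists_mem_croots_of_mem_parts (G := W) hD hM
      exact ⟨ih.1, fun _ => ih.1⟩
  | Gen.merge A B e', s, t, t₀, hD, hM => by
      rw [dated_merge] at hD
      obtain ⟨hle, -, hA, hB⟩ := hD
      have hle' : (sh e').step ≤ t := hle
      by_cases hlt : (sh e').step < t₀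
      · have hM' : Gen.merge Y Z e = Gen.merge A B e' := by simpa [parts, hlt] using hM
        rw [hM']
        refine ⟨⟨[], (mem_croots_merge_iff _ A B e' _).2 (Or.inl rfl)⟩, fun ht₀ => ⟨[], ?_⟩⟩
        have hne : ¬ some t = some ((PEv.step ∘ sh) e') := by
          intro h
          have h1 := Option.some.inj h
          have h2 : t = (sh e').step := h1
          omega
        simp only [crootsP]
        rw [if_neg hne]
        simp
      · have hM' : Gen.merge Y Z e ∈ parts sh t₀ A ++ parts sh t₀ B := by simpa [parts, hlt] using hM
        have ht₀e : t₀ ≤ (sh e').step := not_lt.1 hlt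
        rcases List.mem_append.1 hM' with h | h
        · obtain ⟨a, ha⟩ := (exists_mem_croots_of_mem_parts (G := A) hA h).2 ht₀e
          refine ⟨⟨false :: a, ?_⟩, fun _ => ⟨false :: a, ?_⟩⟩
          · simp only [croots, crootsP, List.mem_append, List.mem_map]
            exact Or.inr (Or.inl ⟨(a, _), ha, rfl⟩)
          · simp only [crootsP, List.mem_append, List.mem_map]
            exact Or.inr (Or.inl ⟨(a, _), ha, rfl⟩)
        · obtain ⟨a, ha⟩ := (exists_mem_croots_of_mem_parts (G := B) hB h).2 ht₀e
          refine ⟨⟨true :: a, ?_⟩, fun _ => ⟨true :: a, ?_⟩⟩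
          · simp only [croots, crootsP, List.mem_append, List.mem_map]
            exact Or.inr (Or.inr ⟨(a, _), ha, rfl⟩)
          · simp only [crootsP, List.mem_append, List.mem_map]
            exact Or.inr (Or.inr ⟨(a, _), ha, rfl⟩)

end Strip

/-! ## §2 Touch-connectedness from a contact forest -/

section Forest

/-- transport of touch-connectedness along a map respecting touch on members [folklore] -/
theorem TConn.map {α β : Type*} {touch : α → α → Prop} {touch' : β → β → Prop} (f : α → β) {l : List α}
    (h : ∀ a ∈ l, ∀ b ∈ l, touch a b → touch' (f a) (f b)) (hc : TConn touch l) : TConn touch' (l.map f) := by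
  intro p hp q hq
  obtain ⟨a, ha, rfl⟩ := List.mem_map.1 hp
  obtain ⟨b, hb, rfl⟩ := List.mem_map.1 hq
  exact Relation.ReflTransGen.lift (p := fun a' b' => a' ∈ l.map f ∧ b' ∈ l.map f ∧ touch' a' b') f
    (fun x y hxy => ⟨List.mem_map.2 ⟨x, hxy.1, rfl⟩, List.mem_map.2 ⟨y, hxy.2.1, rfl⟩, h x hxy.1 y hxy.2.1 hxy.2.2⟩)
    _ _ (hc a ha b hb)

/-- **A CONTACT FOREST MAKES THE PART LIST TOUCH-CONNECTED**: parts indexed by `g : I → α` onto `l`, a forest-admissible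
configuration (`HistorySiblingSymmetry.ForestAdm`: every non-host part touches its parent, ranks decrease towards the
host) and a SYMMETRIC touch `T` on parts implied by the forest's touch ⇒ `TConn T l`. [folklore] -/
theorem tconn_of_forestAdm {I Pos α : Type*} {ok : I → Pos → Prop} {touch : I → Pos → I → Pos → Prop} {h : I}
    {c : I → Pos} (hF : ForestAdm ok touch h c) {l : List α} (g : I → α) (hg : ∀ i, g i ∈ l)
    (hsurj : ∀ a ∈ l, ∃ i, g i = a) {T : α → α → Prop} (hT : ∀ a b, T a b → T b a)
    (htouch : ∀ i j, touch i (c i) j (c j) → T (g i) (g j)) : TConn T l := by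
  obtain ⟨par, ⟨rk, hrk⟩, hpar⟩ := hF
  -- every part reaches the host and back, along its parent chain
  have reach : ∀ (n : ℕ) (i : I), rk i ≤ n →
      Relation.ReflTransGen (fun a b => a ∈ l ∧ b ∈ l ∧ T a b) (g i) (g h) ∧
        Relation.ReflTransGen (fun a b => a ∈ l ∧ b ∈ l ∧ T a b) (g h) (g i) := by
    intro n
    induction n with
    | zero =>
        intro i hi
        by_cases hih : i = h
        · subst hih; exact ⟨Relation.ReflTransGen.refl, Relation.ReflTransGen.refl⟩
        · have := hrk i hih; omega
    | succ n ih =>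
        intro i hi
        by_cases hih : i = h
        · subst hih; exact ⟨Relation.ReflTransGen.refl, Relation.ReflTransGen.refl⟩
        · have hlt := hrk i hih
          have ht := htouch i (par i) (hpar i hih).2
          obtain ⟨ih1, ih2⟩ := ih (par i) (by omega)
          exact ⟨(Relation.ReflTransGen.single ⟨hg i, hg (par i), ht⟩).trans ih1,
            ih2.trans (Relation.ReflTransGen.single ⟨hg (par i), hg i, hT _ _ ht⟩)⟩
  intro p hp q hq
  obtain ⟨i, rfl⟩ := hsurj p hp
  obtain ⟨j, rfl⟩ := hsurj q hq
  exact (reach (rk i) i le_rfl).1.trans (reach (rk j) j le_rfl).2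

end Forest

/-! ## §3 From canonical admissibility to the cluster-contact binder -/

section Bridge

variable {ε γ β R : Type*} [DecidableEq β] [LinearOrder R] {D : ℕ}
  (zone : ℕ → Gen ε → (Addr D → γ) → Finset β) (ρ : (Addr D → γ) → R) (c₀ : γ) (st : ε → ℕ)

/-- **THE LOCAL JOIN CONDITION MAKES THE TOP JOIN'S PARTS TOUCH-CONNECTED**: `LocalTop` at `merge A B e` under `P`
(leaf-05 g2: a contact forest of the parts' displayed zones at `st e`, read at the induced relative placements `cfg`)
and an identification `hzone` of those zones with a function `Zf` of the part alone ⇒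
`TConn (fun a b => (Zf a ∩ Zf b).Nonempty) ((jparts st (merge A B e)).map Prod.snd)`. [folklore] -/
theorem tconn_tparts_of_localTop (A B : Gen ε) (e : ε) (P : Addr D → γ)
    (hloc : LocalTop zone ρ c₀ st (Gen.merge A B e) P) (Zf : Gen ε → Finset β)
    (hzone : ∀ i : Fin (npart st (Gen.merge A B e)),
      zone (st e) (part st _ i).2 (cfg c₀ st A B e P i) = Zf (part st _ i).2) :
    TConn (fun a b => (Zf a ∩ Zf b).Nonempty) ((jparts st (Gen.merge A B e)).map Prod.snd) := by
  have hF := hloc.1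
  refine tconn_of_forestAdm hF (fun i => (part st _ i).2) (fun i => List.mem_map.2 ⟨_, part_mem st _ i, rfl⟩)
    (fun a ha => ?_) (fun a b hab => by rw [inter_comm]; exact hab) (fun i j hij => ?_)
  · obtain ⟨q, hq, rfl⟩ := List.mem_map.1 ha
    obtain ⟨i, hi⟩ := exists_part_eq st hq
    exact ⟨i, by rw [hi]⟩
  · have h : (zone (st e) (part st _ i).2 (cfg c₀ st A B e P i) ∩
        zone (st e) (part st _ j).2 (cfg c₀ st A B e P j)).Nonempty := hij
    rwa [hzone i, hzone j] at h

variable {zone ρ c₀} {sh : ε → PEv}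

/-- **FROM CANONICAL ADMISSIBILITY TO CLUSTER CONTACT OF THE PIECES.**  For a structure `G` canonically admissible under
`P` (leaf-05 g2's `CAdm zone ρ c₀ (step∘sh) G P`) and dated (leaf-02 g3's `Dated`), and a renewal-blind zone function
`Zf` agreeing with the displayed part zones at every join under the induced relative placements (`hzone`): every PIECE
of `G` that is a merger has TOUCH-CONNECTED cluster parts for «`Zf (sh e).step a ∩ Zf (sh e).step b` non-empty» — the
`hconn` binder of `HistoryZoneMassCluster.card_regZoneD_le_pieces` for `Zf`. [folklore] -/
theorem hconn_of_cadm {G : Gen ε} {P : Addr D → γ} (hadm : CAdm zone ρ c₀ (PEv.step ∘ sh) G P) {s : Bool} {T : ℕ}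
    (hD : Dated (PEv.step ∘ sh) s T G) (Zf : ℕ → Gen ε → Finset β)
    (hZr : ∀ (t : ℕ) (Y : Gen ε) (r : ε) (h : ℕ), Zf t (Gen.renew Y r h) = Zf t Y)
    (hzone : ∀ q ∈ croots (PEv.step ∘ sh) G, ∀ i : Fin (npart (PEv.step ∘ sh) q.2),
      zone (ftime (PEv.step ∘ sh) q.2) (part (PEv.step ∘ sh) q.2 i).2
          (rel c₀ (part (PEv.step ∘ sh) q.2 i).1 (rel c₀ q.1 P)) =
        Zf (ftime (PEv.step ∘ sh) q.2) (part (PEv.step ∘ sh) q.2 i).2) :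
    ∀ (t₀ : ℕ) (Y Z : Gen ε) (e : ε), Gen.merge Y Z e ∈ parts sh t₀ G →
      TConn (fun a b => (Zf (sh e).step a ∩ Zf (sh e).step b).Nonempty) (parts sh (sh e).step (Gen.merge Y Z e)) := by
  intro t₀ Y Z e hM
  obtain ⟨a, ha⟩ := (exists_mem_croots_of_mem_parts hD hM).1
  have hloc : LocalTop zone ρ c₀ (PEv.step ∘ sh) (Gen.merge Y Z e) (rel c₀ a P) := hadm _ ha
  have h1 := tconn_tparts_of_localTop zone ρ c₀ (PEv.step ∘ sh) Y Z e (rel c₀ a P) hloc (Zf (sh e).step)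
    (fun i => hzone _ ha i)
  have hDM : Dated (PEv.step ∘ sh) false (sh e).step (Gen.merge Y Z e) := dated_node hD (sub_of_mem_parts t₀ hM)
  rw [parts_eq_map_strip hDM]
  have h2 := TConn.map strip (touch' := fun a b => (Zf (sh e).step a ∩ Zf (sh e).step b).Nonempty)
    (fun a _ b _ hab => by rwa [apply_strip _ (hZr _), apply_strip _ (hZr _)]) h1
  rw [List.map_map] at h2
  exact h2

end Bridge

/-! ## §4 Sanity (decided) -/

namespace Sanity

/-- stripping two renewals off a birth returns the birth; a same-step chain `((A B)₅ C)₅` dated lax at `5` has its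
three births as cut-`5` pieces and as step-`5` cluster parts (both decided; labels ARE steps here via `Prod.fst`) -/
example :
    strip (Gen.renew (Gen.renew (Gen.born (((0, 0, 0) : PEv), 0) 0) (((1, 1, 0) : PEv), 1) 0)
        (((2, 1, 0) : PEv), 2) 1) = Gen.born (((0, 0, 0) : PEv), 0) 0 ∧
    (parts (Prod.fst : PEv × ℕ → PEv) 5
        (Gen.merge (Gen.merge (Gen.born (((0, 0, 0) : PEv), 0) 0) (Gen.born (((1, 0, 0) : PEv), 1) 1)
          (((5, 2, 0) : PEv), 3)) (Gen.born (((2, 0, 0) : PEv), 2) 2) (((5, 2, 0) : PEv), 4))).length = 3 ∧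
    (clusterParts (PEv.step ∘ (Prod.fst : PEv × ℕ → PEv)) 5
        (Gen.merge (Gen.merge (Gen.born (((0, 0, 0) : PEv), 0) 0) (Gen.born (((1, 0, 0) : PEv), 1) 1)
          (((5, 2, 0) : PEv), 3)) (Gen.born (((2, 0, 0) : PEv), 2) 2) (((5, 2, 0) : PEv), 4))).length = 3 := by
  refine ⟨rfl, by decide, by decide⟩

end Sanity

end Summit.QuantumFields.BalabanUV.T4Continuum.HistoryZoneMassBridge
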